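import Literature.NumberTheory.LFunctions.Zhang2022.KnifeEdgeLenZDegreeShortDense

/-!
# Zhang (2022), rung F-S3 (Landau–Siegel programme, §D edge len = E*-len⁺): route `ZDegreeToeplitzBand` —
# the DUAL twin of the density reduction: `dualCrossTablePsiOn_zero_of_dense`

Y. Zhang, *Discrete mean estimates and the Landau–Siegel zero*, arXiv:2211.02515v1 [Zhang2022LandauSiegel] — an
unrefereed manuscript under adjudication. **WHAT THIS IS NOT: not a claim about Theorems 1–2 of arXiv:2211.02515, about
Landau–Siegel zeros, or about Parity. The programme SEARCHES and TYPES; no claim about Landau–Siegel zeros, Theorems 1–2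
of arXiv:2211.02515 or a repaired Margin232 until a kernel theorem says so.** `E₀`-free; every OPEN input is a hypothesis —
this file ELIMINATES NOTHING.

WHAT IS HERE. The dual-slot version of `KnifeEdge.crossTablePsiOn_zero_of_dense` (`KnifeEdgeLenZDegreeShortDense`,
p521442, ls-knife-typer-3 g8): for the ψ-graded DUAL table of degree `d` (`KnifeEdge.DualCrossTablePsiOn c′ 𝒞 d Y`,
`Σ Re𝔠*·Z(ρ,ψ)^d·conj Q_{g₂}·Q_{g₁}·Re ω`), darkness on a sub-class `𝒞₀` + the side tables `InClassMean c′` (K0,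
stmt-Parity-20016, OPEN) with Lemma 2.3 at `c′` + approximation of every in-class pair of `𝒞` by in-class pairs of `𝒞₀` in
the `𝔅`-currency ⇒ darkness on `𝒞`. Same proof (sesquilinear decomposition, Cauchy–Schwarz `norm_zDegMeanPsi_le_sqrt` with
the sign data of Lemma 2.3 + Prop 2.2 (i), `discMean_conj` on BOTH tables, K0 as an upper bound); this is ls-theory g4's
typing debt N3 of the DISPLAY #4 verdict (11:37:13Z): needed before a port can close the short-class dual slot
(`ShortPairsDualDegOne`-type items) from the hand's DISPLAY #4 (Y₁|short dark on piecewise-polynomial short pairs).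

Typer: ls-knife-typer-1 g8 (the K1″a hand; cell landau-siegel §D).

## References
* Y. Zhang, arXiv:2211.02515v1 (2022), §2 Lemma 2.3, (2.15)–(2.17); §7 Prop. 7.1 (7.2); §8 (8.2), (8.5), Lemma 8.1.
  [cite: Zhang2022LandauSiegel, §2 Lemma 2.3, (2.15)–(2.17), §7 Prop 7.1 (7.2), §8 (8.5), Lemma 8.1]
-/

noncomputable section

open Complex Real ComplexConjugate Finset

namespace Literature.NumberTheory.LFunctions.Zhang2022.KnifeEdge

open Repair Skeleton

section DenseDual

variable {c' : ℝ}

/-- **THE DENSITY REDUCTION FOR THE DUAL SLOT (every degree `d`, every pair class `𝒞`).** Suppose: (i) the ψ-graded DUAL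
slot of degree `d` is DARK (zero functional) on the in-class pairs of a sub-class `𝒞₀` — an OPEN input, asserted by no
one; (ii) the side tables `InClassMean c′` (K0, stmt-Parity-20016 — OPEN input) and Lemma 2.3 at `c′`; (iii) every in-class
pair of `𝒞` is, for every `η > 0`, within `𝔅`-distance `η` (in each piece) of an in-class pair of `𝒞₀`. THEN the dual slot is
dark on `𝒞`. Proof = `crossTablePsiOn_zero_of_dense` with the second table conjugated too (`discMean_conj` twice).
[cite: Zhang2022LandauSiegel, §2 Lemma 2.3, (2.15)–(2.17), §7 Prop 7.1, §8 (8.5), Lemma 8.1] -/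
theorem dualCrossTablePsiOn_zero_of_dense {𝒞 𝒞₀ : PairClass} {d : ℕ}
    (hdark : DualCrossTablePsiOn c' 𝒞₀ d (fun _ _ _ _ => 0)) (hK0 : InClassMean c') (h23 : Lemma23 c')
    (hdense : ∀ (g₁ g₁' g₂ g₂' : ℝ → ℂ), InClassPiece g₁ g₁' → InClassPiece g₂ g₂' → 𝒞 g₁ g₁' g₂ g₂' →
      ∀ η : ℝ, 0 < η →
      ∃ g₁N g₁N' g₂N g₂N' : ℝ → ℂ, InClassPiece g₁N g₁N' ∧ InClassPiece g₂N g₂N' ∧ 𝒞₀ g₁N g₁N' g₂N g₂N' ∧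
        mainTermForm (fun x => g₁ x - g₁N x) (fun x => g₁' x - g₁N' x) ≤ η ∧
        mainTermForm (fun x => g₂ x - g₂N x) (fun x => g₂' x - g₂N' x) ≤ η) :
    DualCrossTablePsiOn c' 𝒞 d (fun _ _ _ _ => 0) := by
  intro g₁ g₁' g₂ g₂' hg₁ hg₂ h𝒞 ε hε
  -- sizes of the two pieces in the 𝔅-currency
  set B1 := mainTermForm g₁ g₁' with hB1
  set B2 := mainTermForm g₂ g₂' with hB2
  have hB10 : 0 ≤ B1 := mainTermForm_nonneg_of_isH1 hg₁.kinked.isH1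
  have hB20 : 0 ≤ B2 := mainTermForm_nonneg_of_isH1 hg₂.kinked.isH1
  set B := max B1 B2 with hB
  have hB0 : 0 ≤ B := le_max_of_le_left hB10
  have hBp : 0 < B + 1 := by linarith
  -- the approximation scale
  set η : ℝ := min 1 (min (ε / 16) (ε ^ 2 / (128 * (B + 1)))) with hη
  have hη0 : 0 < η := lt_min zero_lt_one (lt_min (by positivity) (by positivity))
  have hη1 : η ≤ 1 := min_le_left _ _
  have hη16 : η ≤ ε / 16 := (min_le_right _ _).trans (min_le_left _ _)
  have hηsq : η ≤ ε ^ 2 / (128 * (B + 1)) := (min_le_right _ _).trans (min_le_right _ _)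
  have h2η : η + η ≤ ε ^ 2 / (64 * (B + 1)) := by
    have : ε ^ 2 / (64 * (B + 1)) = 2 * (ε ^ 2 / (128 * (B + 1))) := by
      field_simp
      ring
    rw [this]
    linarith
  have hkey : ∀ {Bu : ℝ}, Bu ≤ B → (Bu + η) * (η + η) ≤ (ε / 8) ^ 2 := by
    intro Bu hBu
    have h1 : Bu + η ≤ B + 1 := add_le_add hBu hη1
    calc (Bu + η) * (η + η) ≤ (B + 1) * (ε ^ 2 / (64 * (B + 1))) :=
          mul_le_mul h1 h2η (by positivity) (by positivity)
      _ = (ε / 8) ^ 2 := by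
          field_simp
          ring
  -- the approximants and the differences
  obtain ⟨g₁N, g₁N', g₂N, g₂N', hg₁N, hg₂N, h𝒞₀, hBh1, hBh2⟩ := hdense g₁ g₁' g₂ g₂' hg₁ hg₂ h𝒞 η hη0
  have hh1 : InClassPiece (fun x => g₁ x - g₁N x) (fun x => g₁' x - g₁N' x) := hg₁.sub hg₁N
  have hh2 : InClassPiece (fun x => g₂ x - g₂N x) (fun x => g₂' x - g₂N' x) := hg₂.sub hg₂N
  -- the eventual inputs
  have Edark := hdark g₁N g₁N' g₂N g₂N' hg₁N hg₂N h𝒞₀ (ε / 2) (by positivity)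
  have E1 := discMean_profPoly_le_of_inClassMean hK0 hg₁.kinked hη0
  have E2 := discMean_profPoly_le_of_inClassMean hK0 hg₂.kinked hη0
  have Eh1 := discMean_profPoly_le_of_inClassMean hK0 hh1.kinked hη0
  have Eh2 := discMean_profPoly_le_of_inClassMean hK0 hh2.kinked hη0
  have E3 : ForAllLarge fun D _ _ => 3 ≤ D := ForAllLarge.of_le 3 fun D _ _ hD _ _ => hD
  refine ((((((Edark.and E1).and E2).and Eh1).and Eh2).and (h23.and prop22i_holds)).and E3).mono ?_
  intro D _ χ _ _ hh hA
  obtain ⟨⟨⟨⟨⟨⟨hdk, hK1⟩, hK2⟩, hKh1⟩, hKh2⟩, ⟨h23D, h22D⟩⟩, hD3⟩ := hh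
  -- weights and the unit on the index set
  have hw := weights_nonneg_of hD3 h23D h22D
  have hZ := norm_Zpsi_eq_one_of hD3 h22D
  -- abbreviations
  set N : ℕ := ⌊bigP D⌋₊ + 1 with hN
  set A : ℝ := frakA χ * frakP D with hA'
  have hA0 : 0 ≤ A := mul_nonneg (frakA_nonneg χ) (frakP_nonneg D)
  set H1 : Chr D → ℂ → ℂ := fun x t => profPoly χ x g₁ N t with hH1
  set H2 : Chr D → ℂ → ℂ := fun x t => profPoly χ x g₂ N t with hH2
  set Hh1 : Chr D → ℂ → ℂ := fun x t => profPoly χ x (fun z => g₁ z - g₁N z) N t with hHh1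
  set Hh2 : Chr D → ℂ → ℂ := fun x t => profPoly χ x (fun z => g₂ z - g₂N z) N t with hHh2
  set H1N : Chr D → ℂ → ℂ := fun x t => profPoly χ x g₁N N t with hH1N
  set H2N : Chr D → ℂ → ℂ := fun x t => profPoly χ x g₂N N t with hH2N
  -- the four K0 bounds
  have dm1 : discMean c' χ H1 ≤ (B1 + η) * A := hK1 hA
  have dm2 : discMean c' χ H2 ≤ (B2 + η) * A := hK2 hA
  have dmh1 : discMean c' χ Hh1 ≤ (η + η) * A :=
    (hKh1 hA).trans (mul_le_mul_of_nonneg_right (by linarith) hA0)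
  have dmh2 : discMean c' χ Hh2 ≤ (η + η) * A :=
    (hKh2 hA).trans (mul_le_mul_of_nonneg_right (by linarith) hA0)
  -- darkness of the approximant pair at ε/2
  have hdkN : ‖zDegMeanPsi c' χ d (fun x t => conj (H2N x t)) (fun x t => conj (H1N x t))‖ ≤ ε / 2 * A := by
    have h := hdk hA
    simp only [zero_mul, sub_zero] at h
    rw [hA', ← mul_assoc]
    exact h
  -- the sesquilinear decomposition
  have e1 : (fun x t => conj (H1N x t)) = fun x t => conj (H1 x t) - conj (Hh1 x t) := by
    funext x t
    simp only [hH1, hHh1, hH1N, profPoly_sub, map_sub]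
    ring
  have e2 : (fun x t => conj (H2N x t)) = fun x t => conj (H2 x t) - conj (Hh2 x t) := by
    funext x t
    simp only [hH2, hHh2, hH2N, profPoly_sub, map_sub]
    ring
  have hdecomp : zDegMeanPsi c' χ d (fun x t => conj (H2 x t)) (fun x t => conj (H1 x t)) =
      zDegMeanPsi c' χ d (fun x t => conj (H2N x t)) (fun x t => conj (H1N x t)) +
        zDegMeanPsi c' χ d (fun x t => conj (H2 x t)) (fun x t => conj (Hh1 x t)) +
        zDegMeanPsi c' χ d (fun x t => conj (Hh2 x t)) (fun x t => conj (H1 x t)) -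
        zDegMeanPsi c' χ d (fun x t => conj (Hh2 x t)) (fun x t => conj (Hh1 x t)) := by
    rw [e2, e1, zDegMeanPsi_sub_left, zDegMeanPsi_sub_right, zDegMeanPsi_sub_right]
    ring
  -- Cauchy–Schwarz on the three corrections
  have c1 : ‖zDegMeanPsi c' χ d (fun x t => conj (H2 x t)) (fun x t => conj (Hh1 x t))‖ ≤
      Real.sqrt ((B2 + η) * A * ((η + η) * A)) := by
    refine (norm_zDegMeanPsi_le_sqrt hw hZ _ _ _).trans (Real.sqrt_le_sqrt ?_)
    rw [discMean_conj, discMean_conj]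
    exact mul_le_mul dm2 dmh1 (discMean_nonneg hw _) (by positivity)
  have c2 : ‖zDegMeanPsi c' χ d (fun x t => conj (Hh2 x t)) (fun x t => conj (H1 x t))‖ ≤
      Real.sqrt ((η + η) * A * ((B1 + η) * A)) := by
    refine (norm_zDegMeanPsi_le_sqrt hw hZ _ _ _).trans (Real.sqrt_le_sqrt ?_)
    rw [discMean_conj, discMean_conj]
    exact mul_le_mul dmh2 dm1 (discMean_nonneg hw _) (by positivity)
  have c3 : ‖zDegMeanPsi c' χ d (fun x t => conj (Hh2 x t)) (fun x t => conj (Hh1 x t))‖ ≤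
      Real.sqrt ((η + η) * A * ((η + η) * A)) := by
    refine (norm_zDegMeanPsi_le_sqrt hw hZ _ _ _).trans (Real.sqrt_le_sqrt ?_)
    rw [discMean_conj, discMean_conj]
    exact mul_le_mul dmh2 dmh1 (discMean_nonneg hw _) (by positivity)
  -- evaluate the square roots with the choice of η
  have s1 : Real.sqrt ((B2 + η) * A * ((η + η) * A)) ≤ ε / 8 * A := by
    have hle : (B2 + η) * A * ((η + η) * A) ≤ (ε / 8 * A) ^ 2 := by
      calc (B2 + η) * A * ((η + η) * A) = ((B2 + η) * (η + η)) * A ^ 2 := by ring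
        _ ≤ (ε / 8) ^ 2 * A ^ 2 := mul_le_mul_of_nonneg_right (hkey (le_max_right _ _)) (sq_nonneg A)
        _ = (ε / 8 * A) ^ 2 := by ring
    calc Real.sqrt ((B2 + η) * A * ((η + η) * A)) ≤ Real.sqrt ((ε / 8 * A) ^ 2) := Real.sqrt_le_sqrt hle
      _ = ε / 8 * A := Real.sqrt_sq (by positivity)
  have s2 : Real.sqrt ((η + η) * A * ((B1 + η) * A)) ≤ ε / 8 * A := by
    have hle : (η + η) * A * ((B1 + η) * A) ≤ (ε / 8 * A) ^ 2 := by
      calc (η + η) * A * ((B1 + η) * A) = ((B1 + η) * (η + η)) * A ^ 2 := by ring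
        _ ≤ (ε / 8) ^ 2 * A ^ 2 := mul_le_mul_of_nonneg_right (hkey (le_max_left _ _)) (sq_nonneg A)
        _ = (ε / 8 * A) ^ 2 := by ring
    calc Real.sqrt ((η + η) * A * ((B1 + η) * A)) ≤ Real.sqrt ((ε / 8 * A) ^ 2) := Real.sqrt_le_sqrt hle
      _ = ε / 8 * A := Real.sqrt_sq (by positivity)
  have s3 : Real.sqrt ((η + η) * A * ((η + η) * A)) ≤ ε / 8 * A := by
    rw [show (η + η) * A * ((η + η) * A) = ((η + η) * A) ^ 2 by ring,
      Real.sqrt_sq (by positivity)]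
    exact mul_le_mul_of_nonneg_right (by linarith) hA0
  -- assemble
  have hgoal : ‖zDegMeanPsi c' χ d (fun x t => conj (H2 x t)) (fun x t => conj (H1 x t))‖ ≤ ε * A := by
    rw [hdecomp]
    calc ‖zDegMeanPsi c' χ d (fun x t => conj (H2N x t)) (fun x t => conj (H1N x t)) +
            zDegMeanPsi c' χ d (fun x t => conj (H2 x t)) (fun x t => conj (Hh1 x t)) +
            zDegMeanPsi c' χ d (fun x t => conj (Hh2 x t)) (fun x t => conj (H1 x t)) -
            zDegMeanPsi c' χ d (fun x t => conj (Hh2 x t)) (fun x t => conj (Hh1 x t))‖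
        ≤ ‖zDegMeanPsi c' χ d (fun x t => conj (H2N x t)) (fun x t => conj (H1N x t))‖ +
            ‖zDegMeanPsi c' χ d (fun x t => conj (H2 x t)) (fun x t => conj (Hh1 x t))‖ +
            ‖zDegMeanPsi c' χ d (fun x t => conj (Hh2 x t)) (fun x t => conj (H1 x t))‖ +
            ‖zDegMeanPsi c' χ d (fun x t => conj (Hh2 x t)) (fun x t => conj (Hh1 x t))‖ :=
          (norm_sub_le _ _).trans (by gcongr; exact (norm_add_le _ _).trans (by gcongr; exact norm_add_le _ _))
      _ ≤ ε / 2 * A + ε / 8 * A + ε / 8 * A + ε / 8 * A :=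
          add_le_add (add_le_add (add_le_add hdkN (c1.trans s1)) (c2.trans s2)) (c3.trans s3)
      _ ≤ ε * A := by nlinarith [hA0, hε.le]
  simpa only [zero_mul, sub_zero, hA', mul_assoc] using hgoal

/-- The same for all large `c′` with Lemma 2.3 DISCHARGED by the tree (`lemma23_eventually`).
[cite: Zhang2022LandauSiegel, §2 Lemma 2.3, §8 (8.5)] -/
theorem dualCrossTablePsiOn_zero_of_dense_eventually :
    ∃ c₀ : ℝ, 0 ≤ c₀ ∧ ∀ c' : ℝ, c₀ ≤ c' → ∀ {𝒞 𝒞₀ : PairClass} {d : ℕ},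
      DualCrossTablePsiOn c' 𝒞₀ d (fun _ _ _ _ => 0) → InClassMean c' →
      (∀ (g₁ g₁' g₂ g₂' : ℝ → ℂ), InClassPiece g₁ g₁' → InClassPiece g₂ g₂' → 𝒞 g₁ g₁' g₂ g₂' → ∀ η : ℝ, 0 < η →
        ∃ g₁N g₁N' g₂N g₂N' : ℝ → ℂ, InClassPiece g₁N g₁N' ∧ InClassPiece g₂N g₂N' ∧ 𝒞₀ g₁N g₁N' g₂N g₂N' ∧
          mainTermForm (fun x => g₁ x - g₁N x) (fun x => g₁' x - g₁N' x) ≤ η ∧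
          mainTermForm (fun x => g₂ x - g₂N x) (fun x => g₂' x - g₂N' x) ≤ η) →
      DualCrossTablePsiOn c' 𝒞 d (fun _ _ _ _ => 0) := by
  obtain ⟨c₀, h0, h⟩ := lemma23_eventually
  exact ⟨c₀, h0, fun c' hc' _ _ _ hdark hK0 hdense => dualCrossTablePsiOn_zero_of_dense hdark hK0 (h c' hc') hdense⟩

end DenseDual

end Literature.NumberTheory.LFunctions.Zhang2022.KnifeEdge

end
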